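import Literature.NumberTheory.DiophantineGeometry.FermatFunctionFieldBelyiMap
import Mathlib.FieldTheory.AlgebraicClosure
import HarnessLib

/-!
# Passing to the full constant field of a covering of prescribed signature

Topic: `Literature/NumberTheory/DiophantineGeometry`. Theorem-only file (no definition, no named
fact), a tool for the covering input of Darmon–Granville's Theorem 2
(`finite_properSolutions_of_belyiMap_of_faltings`, `AbcDarmonGranvilleSignatureReduction`), which asks
for a function field `F` over a number field `K` that is its FULL constant field
(`IsIntegrallyClosedIn K F`) together with `f ∈ F ∖ K` of prescribed orders at the zeros of `f`, of
`f - 1`, at the poles, and unramified over the other closed points of the `f`-line. When a covering is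
written down explicitly (`FermatFunctionFieldBelyiMap`, …) the constant field of the function field one
constructs need not be `K`; this file shows that nothing is lost by replacing `K` with the full
constant field `K' = ` the algebraic closure of `K` in `F`
(`AlgFunctionField.exists_fullConstantField_of_signature`):

* `K'` is a number field: it embeds `K`-linearly into the residue field of any place, which is finite
  over `K` (Stichtenoth Cor. 1.1.16: `[K̃ : K] < ∞`; here for any `K`, given a place — the tree's
  `finiteDimensional_algebraicClosure` of `FunctionFieldHasseWeilProofs` is the finite-field case);
* `F/K'` is an algebraic function field with full constant field `K'`
  (private general-`K` copies of the tree's finite-field instances of `FunctionFieldHasseWeilProofs`),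
  and `f` stays transcendental;
* a place of `F/K'` is a place of `F/K` with the same valuation ring and the same orders, so the three
  order conditions are unchanged;
* the unramifiedness over the closed points `π₀' ∉ {X, X - 1}` of the `f`-line over `K'` follows
  from the one over `K` (`ord_aeval_eq_one_of_isAlgebraic_base`): `π₀'` is the minimal polynomial over
  `K'` of the value `f(Q)`, it divides the minimal polynomial `π ∉ {X, X - 1}` over `K`, and
  `v_Q(π(f)) = 1` forces `v_Q(π₀'(f)) = 1` (the tree's `PlaceOver.ord_aeval_eq_one_of_dvd`).

## References

* H. Stichtenoth, *Algebraic Function Fields and Codes*, GTM 254, 2009: Prop. 1.1.5, Cor. 1.1.16,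
  §3.6. [Stichtenoth2009]
* H. Darmon, A. Granville, *On the equations `z^m = F(x, y)` and `A x^p + B y^q = C z^r`*, Bull. London
  Math. Soc. 27 (1995) 513–543: Prop. 3.1 (p. 525). [DarmonGranville1995]
-/

noncomputable section

open scoped Classical Polynomial IntermediateField NumberField

namespace Literature.NumberTheory.DiophantineGeometry.AlgFunctionField

open Polynomial

universe u v

section FullConstantField

variable {K : Type u} {F : Type v} [Field K] [Field F] [Algebra K F] [IsAlgFunctionField K F]

omit [IsAlgFunctionField K F] in
/-- Elements of `F` algebraic over `K` lie in every valuation ring: the full constant field is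
contained in `𝒪_P`. [cite: Stichtenoth2009, Prop. 1.1.5] -/
theorem PlaceOver.mem_toValuationSubring_of_mem_algebraicClosure (P : PlaceOver K F) {x : F}
    (hx : x ∈ algebraicClosure K F) : x ∈ P.toValuationSubring :=
  IsAlgFunctionField.mem_valuationSubring_of_isAlgebraic P.toValuationSubring P.algebraMap_mem
    (mem_algebraicClosure_iff.1 hx)

/-- **The full constant field is a finite extension of `K`** (Stichtenoth Cor. 1.1.16): it embeds
`K`-linearly into the residue field `F_P` of any place `P`, and `[F_P : K] < ∞`.
[cite: Stichtenoth2009, Cor. 1.1.16] -/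
private theorem finiteDimensional_algebraicClosure_aux (P : PlaceOver K F) :
    FiniteDimensional K (algebraicClosure K F) := by
  haveI : FiniteDimensional K P.residueField := PlaceOver.finiteDimensional_residueField_holds P
  -- the `K`-linear map `K' → 𝒪_P → F_P`
  let φ : algebraicClosure K F →ₗ[K] P.residueField :=
    { toFun := fun x => IsLocalRing.residue P.toValuationSubring
        ⟨(x : F), P.mem_toValuationSubring_of_mem_algebraicClosure x.2⟩
      map_add' := fun x y => by
        rw [← map_add]; rfl
      map_smul' := fun c x => by
        rw [RingHom.id_apply, Algebra.smul_def, Algebra.smul_def, P.algebraMap_residueField_apply,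
          ← map_mul]
        rfl }
  refine FiniteDimensional.of_injective φ fun x y hxy => ?_
  -- injectivity: `x - y ∈ K'` is algebraic, so a unit at `P` unless `0`
  by_contra hne
  have hsub : ((x : F) - y) ≠ 0 := sub_ne_zero.2 fun h => hne (Subtype.ext h)
  have halg : IsAlgebraic K ((x : F) - y) := mem_algebraicClosure_iff.1 (sub_mem x.2 y.2)
  have h0 : P.ord ((x : F) - y) = 0 := P.ord_eq_zero_of_isAlgebraic hsub halg
  have hmem : ((x : F) - y) ∈ P.toValuationSubring :=
    P.mem_toValuationSubring_of_mem_algebraicClosure (sub_mem x.2 y.2)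
  have hres : IsLocalRing.residue P.toValuationSubring ⟨(x : F) - y, hmem⟩ = 0 := by
    have heq : (⟨(x : F) - y, hmem⟩ : P.toValuationSubring) =
        ⟨(x : F), P.mem_toValuationSubring_of_mem_algebraicClosure x.2⟩ -
          ⟨(y : F), P.mem_toValuationSubring_of_mem_algebraicClosure y.2⟩ := rfl
    rw [heq, map_sub]
    exact sub_eq_zero.2 hxy
  have hpos := (P.residue_eq_zero_iff_ord_pos hmem hsub).1 hres
  omega

variable (K F) in
/-- **`F` is an algebraic function field over its full constant field `K'`**: `trdeg_{K'} F =
trdeg_K F - trdeg_K K' = 1` and `F` is finitely generated over `K' ⊇ K`.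
[cite: Stichtenoth2009, §1.1 (K̃) and Cor. 1.1.16] -/
private theorem isAlgFunctionField_algebraicClosure_aux :
    IsAlgFunctionField (algebraicClosure K F) F where
  trdeg_eq_one := by
    have h := trdeg_add_eq K (algebraicClosure K F) (A := F)
    rw [trdeg_eq_zero (R := K) (A := algebraicClosure K F), zero_add,
      IsAlgFunctionField.trdeg_eq_one (K := K) (F := F)] at h
    exact h
  fg_top := by
    haveI : Algebra.EssFiniteType K F :=
      IntermediateField.fg_top_iff.mp (IsAlgFunctionField.fg_top (K := K) (F := F))
    haveI : Algebra.EssFiniteType (algebraicClosure K F) F :=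
      Algebra.EssFiniteType.of_comp K (algebraicClosure K F) F
    exact IntermediateField.fg_top_iff.mpr this

variable (K F) in
omit [IsAlgFunctionField K F] in
/-- `K'` is integrally (= algebraically) closed in `F`. [cite: Stichtenoth2009, §1.1 (K̃)] -/
private theorem isIntegrallyClosedIn_algebraicClosure_aux :
    IsIntegrallyClosedIn (algebraicClosure K F) F := by
  refine (isIntegrallyClosedIn_iff (R := algebraicClosure K F) (A := F)).2
    ⟨(algebraMap (algebraicClosure K F) F).injective, fun {x} hx => ?_⟩
  exact ⟨⟨x, mem_algebraicClosure_iff'.2 (isIntegral_trans x hx)⟩, rfl⟩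

omit [IsAlgFunctionField K F] in
/-- **Unramifiedness over the closed points of the `f`-line passes to an algebraic extension of the
constant field inside `F`.** Let `L` be an intermediate field of `F/K` algebraic over `K`, `f ∈ F`
transcendental over `K` with `v_P(π(f)) ∈ {0, 1}` for every place `P` of `F/K` and every monic
irreducible `π ∈ K[X]`, `π ∉ {X, X - 1}`. Then `v_Q(π₀'(f)) ∈ {0, 1}` for every place `Q` of `F/L` and
every monic irreducible `π₀' ∈ L[X]`, `π₀' ∉ {X, X - 1}`: `π₀' = minpoly_L(f(Q))` divides
`π = minpoly_K(f(Q)) ∉ {X, X - 1}`, and `v_Q(π(f)) = 1`. [folklore] -/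
theorem ord_aeval_eq_one_of_isAlgebraic_base {f : F} (hf : Transcendental K f)
    (hunr : ∀ π₀ : K[X], Irreducible π₀ → π₀.Monic → π₀ ≠ X → π₀ ≠ X - 1 →
      ∀ P : PlaceOver K F, 0 < P.ord (aeval f π₀) → P.ord (aeval f π₀) = 1)
    (L : IntermediateField K F) [Algebra.IsAlgebraic K L]
    (π₀' : L[X]) (hπi : Irreducible π₀') (hπm : π₀'.Monic) (hπX : π₀' ≠ X) (hπX1 : π₀' ≠ X - 1)
    (Q : PlaceOver L F) (hQ : 0 < Q.ord (aeval f π₀')) : Q.ord (aeval f π₀') = 1 := by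
  have hz0 : aeval f π₀' ≠ 0 := by
    intro h0; rw [h0, PlaceOver.ord_zero] at hQ; exact lt_irrefl _ hQ
  have hdeg : 0 < π₀'.natDegree := Irreducible.natDegree_pos hπi
  have hfO : f ∈ Q.toValuationSubring := Q.mem_of_ord_aeval_pos hdeg hQ
  set α : Q.residueField := IsLocalRing.residue Q.toValuationSubring ⟨f, hfO⟩ with hα
  have hroot : aeval α π₀' = 0 := (Q.ord_aeval_pos_iff hfO hz0).1 hQ
  -- `F_Q` as a `K`-algebra through `L`
  letI : Algebra K Q.residueField :=
    ((algebraMap L Q.residueField).comp (algebraMap K L)).toAlgebra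
  haveI : IsScalarTower K L Q.residueField := IsScalarTower.of_algebraMap_eq fun _ => rfl
  -- `π₀' = minpoly_L(α)`, `π = minpoly_K(α)`
  have hπ₀' : π₀' = minpoly L α := minpoly.eq_of_irreducible_of_monic hπi hroot hπm
  have hintL : IsIntegral L α := ⟨π₀', hπm, by rwa [← aeval_def]⟩
  have hintK : IsIntegral K α := isIntegral_trans α hintL
  set π : K[X] := minpoly K α with hπ
  have hπi' : Irreducible π := minpoly.irreducible hintK
  have hπm' : π.Monic := minpoly.monic hintK
  have hdvd : π₀' ∣ π.map (algebraMap K L) := by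
    rw [hπ₀']; exact minpoly.dvd_map_of_isScalarTower K L α
  -- `π ∉ {X, X - 1}`: otherwise `α ∈ {0, 1}` and `π₀' ∈ {X, X - 1}`
  have hπX' : π ≠ X := by
    intro h
    have hα0 : α = 0 := by
      have h2 := minpoly.aeval K α
      rwa [← hπ, h, aeval_X] at h2
    apply hπX
    rw [hπ₀', hα0, minpoly.zero]
  have hπX1' : π ≠ X - 1 := by
    intro h
    have hα1 : α = 1 := by
      have h2 := minpoly.aeval K α
      rwa [← hπ, h, map_sub, aeval_X, map_one, sub_eq_zero] at h2
    apply hπX1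
    rw [hπ₀', hα1, show (1 : Q.residueField) = algebraMap L Q.residueField 1 from (map_one _).symm,
      minpoly.eq_X_sub_C, map_one]
  -- `v_Q(π(f)) = 1` as a place of `F/K`
  have haeval : aeval f (π.map (algebraMap K L)) = aeval f π := aeval_map_algebraMap L f π
  have hψ0 : aeval f (π.map (algebraMap K L)) ≠ 0 := by
    rw [haeval]
    exact fun h0 => hf ⟨π, hπi'.ne_zero, h0⟩
  obtain ⟨ρ, hρ⟩ := hdvd
  have hρ0 : aeval f ρ ≠ 0 := by
    intro h0; apply hψ0; rw [hρ, map_mul, h0, mul_zero]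
  let QK : PlaceOver K F :=
    { toValuationSubring := Q.toValuationSubring
      ne_top := Q.ne_top
      isDVR := Q.isDVR
      algebraMap_mem := fun c => by
        have h := Q.algebraMap_mem (algebraMap K L c)
        rwa [← IsScalarTower.algebraMap_apply] at h }
  have hordK : ∀ x : F, QK.ord x = Q.ord x := fun x => rfl
  have hpos : 0 < QK.ord (aeval f π) := by
    rw [hordK, ← haeval, hρ, map_mul, Q.ord_mul_eq hz0 hρ0]
    have hnn := Q.ord_nonneg_of_mem (Q.aeval_mem hfO ρ)
    omega
  have h1 : QK.ord (aeval f π) = 1 := hunr π hπi' hπm' hπX' hπX1' QK hpos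
  have h1' : Q.ord (aeval f (π.map (algebraMap K L))) = 1 := by rw [haeval, ← hordK]; exact h1
  exact Q.ord_aeval_eq_one_of_dvd hfO ⟨ρ, hρ⟩ hψ0 h1' hQ

/-- **Passing to the full constant field.** Let `K` be a number field, `F/K` an algebraic function
field (with `K` not necessarily the full constant field) and `f ∈ F` transcendental over `K` with
`v_P(f) = a` at every zero, `v_P(f - 1) = b` at every zero of `f - 1`, `v_P(f) = c` at every pole, and
`v_P(π₀(f)) ∈ {0, 1}` for every monic irreducible `π₀ ∈ K[X]`, `π₀ ∉ {X, X - 1}`. Then the same data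
exist over a number field `K'` that IS the full constant field of `F` (namely the algebraic closure of
`K` in `F`): the covering in the shape consumed by `finite_properSolutions_of_belyiMap_of_faltings`.
[cite: Stichtenoth2009, Cor. 1.1.16] [cite: DarmonGranville1995, Prop. 3.1 (p. 525)] -/
theorem exists_fullConstantField_of_signature [NumberField K] {f : F} (hf : Transcendental K f)
    {a b c : ℤ}
    (h₀ : ∀ P : PlaceOver K F, 0 < P.ord f → P.ord f = a)
    (h₁ : ∀ P : PlaceOver K F, 0 < P.ord (f - 1) → P.ord (f - 1) = b)
    (hi : ∀ P : PlaceOver K F, P.ord f < 0 → P.ord f = c)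
    (hunr : ∀ π₀ : K[X], Irreducible π₀ → π₀.Monic → π₀ ≠ X → π₀ ≠ X - 1 →
      ∀ P : PlaceOver K F, 0 < P.ord (aeval f π₀) → P.ord (aeval f π₀) = 1) :
    ∃ (K' : Type v) (_ : Field K') (_ : NumberField K') (_ : Algebra K' F)
      (_ : IsAlgFunctionField K' F) (_ : IsIntegrallyClosedIn K' F),
      f ∉ Set.range (algebraMap K' F) ∧
      (∀ P : PlaceOver K' F, 0 < P.ord f → P.ord f = a) ∧
      (∀ P : PlaceOver K' F, 0 < P.ord (f - 1) → P.ord (f - 1) = b) ∧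
      (∀ P : PlaceOver K' F, P.ord f < 0 → P.ord f = c) ∧
      (∀ π₀ : K'[X], Irreducible π₀ → π₀.Monic → π₀ ≠ X → π₀ ≠ X - 1 →
        ∀ P : PlaceOver K' F, 0 < P.ord (aeval f π₀) → P.ord (aeval f π₀) = 1) := by
  obtain ⟨P₀, -⟩ := exists_ord_pos_of_transcendental hf
  haveI : FiniteDimensional K (algebraicClosure K F) := finiteDimensional_algebraicClosure_aux P₀
  haveI hNF : NumberField (algebraicClosure K F) := NumberField.of_module_finite K _
  -- a place over `K'` is a place over `K` with the same orders
  have hplace : ∀ Q : PlaceOver (algebraicClosure K F) F, ∃ P : PlaceOver K F,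
      ∀ x : F, P.ord x = Q.ord x := fun Q =>
    ⟨{ toValuationSubring := Q.toValuationSubring
       ne_top := Q.ne_top
       isDVR := Q.isDVR
       algebraMap_mem := fun c => by
         have h := Q.algebraMap_mem (algebraMap K (algebraicClosure K F) c)
         rwa [← IsScalarTower.algebraMap_apply] at h }, fun _ => rfl⟩
  refine ⟨algebraicClosure K F, inferInstance, hNF, inferInstance,
    isAlgFunctionField_algebraicClosure_aux K F, isIntegrallyClosedIn_algebraicClosure_aux K F,
    ?_, ?_, ?_, ?_, ?_⟩
  · rintro ⟨c', hc⟩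
    exact hf.algebraicClosure (hc ▸ isAlgebraic_algebraMap c')
  · intro Q hQ
    obtain ⟨P, hP⟩ := hplace Q
    rw [← hP] at hQ ⊢
    exact h₀ P hQ
  · intro Q hQ
    obtain ⟨P, hP⟩ := hplace Q
    rw [← hP] at hQ ⊢
    exact h₁ P hQ
  · intro Q hQ
    obtain ⟨P, hP⟩ := hplace Q
    rw [← hP] at hQ ⊢
    exact hi P hQ
  · intro π₀ hπi hπm hX hX1 Q hQ
    exact ord_aeval_eq_one_of_isAlgebraic_base hf hunr _ π₀ hπi hπm hX hX1 Q hQ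

end FullConstantField

end Literature.NumberTheory.DiophantineGeometry.AlgFunctionField
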